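import Summits.BirchSwinnertonDyer.BirchSwinnertonDyer.Theorems.ThetaPartnerAtTwoSignedKatoUpToAtTwoOmegaDivisionCharValues
import Literature.NumberTheory.EllipticCurves.PlusMinusPAdicLFunctionProofs
import Literature.NumberTheory.EllipticCurves.Sprung2012.LocalTowerTraceProofs
import HarnessLib

/-!
# Route `ThetaPartnerAtTwo` (TP2), crux K3 `SignedKatoDivisibilityUpToAtTwo` (item stmt-BirchSwinnertonDyer-20308) /
# K3P′ (stmt-BirchSwinnertonDyer-25631), line `colemanrat` v11 — the DISTRIBUTION RELATIONS behind «primitive characters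
# suffice» for the character-value socket CORE_χ: both sides of (ERL_χ) drop two levels by the same factor `−Φ_{p^{n+1}}(ζ)`

Width seat `bsd-wall-tp2-p2x-w3` g6 (cell `bsd-wall`). HONEST FRAMING: theorems only (no definition, no named fact, no instance,
no `sorry`); algebra of Mazur–Tate elements and of orbit sums of points in a cyclotomic tower; closes no item; K3 / K3P′ are NOT
settled and BSD is NOT proved by any of this. Sequel: `…CoreOfPrimitiveCharValues.lean` (`CoreChi.coreChi_of_coreChiPrim`).

## What is here

In (ERL_χ) (socket CORE_χ, `…CoreOfCharValues.lean`) the two sides at a character `χ` of `G_{n+2}` that is NOT primitive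
(`χ(γ)^{p^{n+1}} = 1`, i.e. `χ` comes from `G_{n+1}`) are governed by the SAME three-term relation with `a_p = 0`:
* §1 (θ-side, any prime `p`, rational newform with `a_p = 0`) `eval₂_mazurTateElement_add_two_eq`:
  `θ_{n+2}(ζ − 1) = −Φ_{p^{n+1}}(ζ) · θ_n(ζ − 1)` for `ζ^{p^{n+1}} = 1`, `Φ_{p^{n+1}}(ζ) = ∑_{i<p} ζ^{pⁿ i}` — the tree's
  `cyclotomicOmega_dvd_mazurTateElement_add` («`ω_{n+1} ∣ θ_{n+2} + Φ_{p^{n+1}}(1+T) θ_n`», Mazur–Tate–Teitelbaum §I.10 (10.2)) evaluated.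
* §2 (P-side, any `p`, any base, any functional `z` on the local tower) `sum_evalOn_pow_smul_add_two_eq`:
  `∑_{j<p^{n+2}} z(gʲ d_{n+2}) ζʲ = −Φ_{p^{n+1}}(ζ) · ∑_{j<pⁿ} z(gʲ d_n) ζʲ` for `ζ^{p^{n+1}} = 1`, from the trace relation
  (TR) `Tr_{n+2/n+1} d_{n+2} = −d_n` of a plus Honda system (`a_p = 0`), `Tr_{n+2/n+1} = ∑_{k<p} g^{p^{n+1}k}`
  (`localTraceOfEmb_succ_eq_sum_pow_smul`) and `g^{pⁿk} d_n = d_n` (`pow_mul_smul_of_mem_localLayerPointsOfEmb`).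
So an imprimitive `χ` of `G_{n+2}` either kills both sides (`Φ_{p^{n+1}}(χ(γ)) = 0`, conductor exactly one level down) or reduces
(ERL_χ) at level `n+2` to (ERL_χ) at level `n` for the same values `μ(χ(γ)−1)`, `ν(χ(γ)−1)`.

References: [MazurTateTeitelbaum1986Invent] §I.10 Prop. (10.2); [Kobayashi2003] Def. 1.1, §8.4 (trace relations), proof of Thm. 6.3 (p. 25);
[Sprung2012] Thm. 2.2, Def. 3.1; [Kato2004Asterisque] Thm. 12.5 (1).
-/

set_option autoImplicit false
-- the Theorems namespace of this sub repeats the summit name by design (D-0017 nested layout)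
set_option linter.dupNamespace false

noncomputable section

open scoped Classical

open Polynomial Literature.NumberTheory.EllipticCurves Literature.NumberTheory.EllipticCurves.ModularForms
  Literature.NumberTheory.EllipticCurves.Kobayashi2003 Literature.NumberTheory.EllipticCurves.Sprung2012
  Literature.NumberTheory.GaloisRepresentations ZpExtension

namespace Summit.BirchSwinnertonDyer.BirchSwinnertonDyer.Theorems.SignedKatoOffTwo.CoreChi

/-! ## §0 Splitting a sum over `range (a·b)` -/

/-- `∑_{j < a·b} F(j) = ∑_{k<b} ∑_{i<a} F(i + a·k)`. [folklore] -/
theorem sum_range_mul_eq_sum_sum {M : Type*} [AddCommMonoid M] (F : ℕ → M) (a b : ℕ) :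
    ∑ j ∈ Finset.range (a * b), F j = ∑ k ∈ Finset.range b, ∑ i ∈ Finset.range a, F (i + a * k) := by
  induction b with
  | zero => simp
  | succ b ih =>
    rw [Nat.mul_succ, Finset.sum_range_add, ih, Finset.sum_range_succ]
    refine congrArg _ (Finset.sum_congr rfl fun i _ ↦ ?_)
    rw [add_comm (a * b) i]

/-! ## §1 The θ-side: `θ_{n+2}(ζ − 1) = −Φ_{p^{n+1}}(ζ) θ_n(ζ − 1)` for `ζ^{p^{n+1}} = 1` -/

section Theta

variable {p : ℕ} [hp : Fact p.Prime] {N : ℕ} [NeZero N] {f : CuspForm (CongruenceSubgroup.Gamma0 N) 2}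

/-- **The three-term relation of the Mazur–Tate elements at `a_p = 0`, evaluated at a character of `G_{n+1}`**: for a rational
newform `f` of level prime to `p` with `a_p(f) = 0` and `ζ ∈ ℂ_p` with `ζ^{p^{n+1}} = 1`,
`θ_{n+2}(ζ − 1) = −(∑_{i<p} ζ^{pⁿ i}) · θ_n(ζ − 1)` (`∑_{i<p} ζ^{pⁿi} = Φ_{p^{n+1}}(ζ)`). From
`ω_{n+1} ∣ θ_{n+2} + Φ_{p^{n+1}}(1+T)·θ_n` (`cyclotomicOmega_dvd_mazurTateElement_add`) and `ω_{n+1}(ζ − 1) = ζ^{p^{n+1}} − 1 = 0`.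
[cite: MazurTateTeitelbaum1986Invent, §I.10 Prop. (10.2)] -/
theorem eval₂_mazurTateElement_add_two_eq (hf0 : IsNewform0 f) (hQ : coeffField f = ⊥) (hpN : ¬ p ∣ N)
    (hap : cuspCoeff f p = ((0 : ℤ) : ℂ)) (n : ℕ) {ζ : ℂ_[p]} (hζ : ζ ^ p ^ (n + 1) = 1) :
    (mazurTateElement f p (n + 2)).eval₂ (algebraMap ℚ ℂ_[p]) (ζ - 1) =
      -((∑ i ∈ Finset.range p, ζ ^ (p ^ n * i)) * (mazurTateElement f p n).eval₂ (algebraMap ℚ ℂ_[p]) (ζ - 1)) := by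
  obtain ⟨q, hq⟩ := cyclotomicOmega_dvd_mazurTateElement_add hf0 hQ hpN hap n
  set ι : ℚ →+* ℂ_[p] := algebraMap ℚ ℂ_[p] with hι
  have h := congrArg (Polynomial.eval₂ ι (ζ - 1)) hq
  -- `ω_{n+1}(ζ - 1) = 0`
  have hω : ((cyclotomicOmega p (n + 1)).map (Int.castRingHom ℚ)).eval₂ ι (ζ - 1) = 0 := by
    rw [eval₂_map, cyclotomicOmega, eval₂_sub, eval₂_pow, eval₂_add, eval₂_X, eval₂_one, sub_add_cancel, hζ, sub_self]
  -- `Φ_{p^{n+1}}(1+T)` at `ζ - 1` is `∑_{i<p} ζ^{pⁿ i}`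
  have hΦ : (((cyclotomic (p ^ (n + 1)) ℤ).comp (X + 1)).map (Int.castRingHom ℚ)).eval₂ ι (ζ - 1) =
      ∑ i ∈ Finset.range p, ζ ^ (p ^ n * i) := by
    rw [eval₂_map, eval₂_comp, eval₂_add, eval₂_X, eval₂_one, sub_add_cancel,
      cyclotomic_prime_pow_eq_geom_sum hp.out, eval₂_finsetSum]
    refine Finset.sum_congr rfl fun i _ ↦ ?_
    rw [eval₂_pow, eval₂_pow, eval₂_X, pow_mul]
  rw [eval₂_mul, hω, zero_mul, eval₂_add, eval₂_mul, hΦ] at h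
  linear_combination h

end Theta

/-! ## §2 The P-side: `∑_{j<p^{n+2}} z(gʲ d_{n+2}) ζʲ = −Φ_{p^{n+1}}(ζ) ∑_{j<pⁿ} z(gʲ d_n) ζʲ` for `ζ^{p^{n+1}} = 1` -/

section Orbit

universe u

variable {K : Type u} [Field K] {p : ℕ} [hp : Fact p.Prime] (κ : ZpExtension K p)
  {E : Type u} [Field E] [Algebra K E] (ι : AlgebraicClosure K →ₐ[K] AlgebraicClosure E)
  (W : WeierstrassCurve K)

/-- `Sprung2012.evalOn` of a functional on an additive subgroup `A` is additive on `A` (off `A` it is junk). [folklore] -/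
theorem evalOn_add_of_mem' {R : Type*} [CommRing R] (A : AddSubgroup (localPoints W E)) (z : A →+ ℤ_[p])
    (φ : ℤ_[p] →+* R) {P Q : localPoints W E} (hP : P ∈ A) (hQ : Q ∈ A) :
    φ (evalOn W A z (P + Q)) = φ (evalOn W A z P) + φ (evalOn W A z Q) := by
  rw [evalOn_of_mem W A z (add_mem hP hQ), evalOn_of_mem W A z hP, evalOn_of_mem W A z hQ, ← map_add, ← map_add]
  rfl

/-- `Sprung2012.evalOn` sends a finite sum of elements of `A` to the sum of the values. [folklore] -/
theorem evalOn_sum_of_mem {R : Type*} [CommRing R] (A : AddSubgroup (localPoints W E)) (z : A →+ ℤ_[p])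
    (φ : ℤ_[p] →+* R) {ιx : Type*} (s : Finset ιx) (P : ιx → localPoints W E) (hP : ∀ i ∈ s, P i ∈ A) :
    φ (evalOn W A z (∑ i ∈ s, P i)) = ∑ i ∈ s, φ (evalOn W A z (P i)) := by
  classical
  induction s using Finset.induction_on with
  | empty =>
    rw [Finset.sum_empty, Finset.sum_empty, evalOn_of_mem W A z (zero_mem A)]
    exact (congrArg φ (map_zero z)).trans (map_zero φ)
  | insert a s ha ih =>
    rw [Finset.sum_insert ha, Finset.sum_insert ha,
      evalOn_add_of_mem' W A z φ (hP a (Finset.mem_insert_self a s))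
        (AddSubgroup.sum_mem A fun i hi ↦ hP i (Finset.mem_insert_of_mem hi)),
      ih fun i hi ↦ hP i (Finset.mem_insert_of_mem hi)]

/-- `Sprung2012.evalOn` at `−P`, `P ∈ A`, is minus the value. [folklore] -/
theorem evalOn_neg_of_mem {R : Type*} [CommRing R] (A : AddSubgroup (localPoints W E)) (z : A →+ ℤ_[p])
    (φ : ℤ_[p] →+* R) {P : localPoints W E} (hP : P ∈ A) :
    φ (evalOn W A z (-P)) = -φ (evalOn W A z P) := by
  rw [evalOn_of_mem W A z (neg_mem hP), evalOn_of_mem W A z hP, ← map_neg, ← map_neg]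
  rfl

/-- **The P-side distribution relation at `a_p = 0`.** Let `g ∈ Γ_E` restrict to the topological generator of `Γ = Gal(K_∞/K)`,
`d : ℕ → E(K̄_E)` with `d_m ∈ E(K_m·E)` for all `m` and the plus-Honda trace relation `Tr_{n+2/n+1} d_{n+2} = −d_n`, `z` any
`ℤ_p`-valued functional on the tower points `E(K_∞·E)` and `φ` a ring map to a commutative ring containing `ζ` with
`ζ^{p^{n+1}} = 1`. Then `∑_{j<p^{n+2}} φ(z(gʲ d_{n+2})) ζʲ = −(∑_{i<p} ζ^{pⁿ i}) · ∑_{j<pⁿ} φ(z(gʲ d_n)) ζʲ`: group `j = j' + p^{n+1}k`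
(`ζ^j = ζ^{j'}`, `∑_k g^{p^{n+1}k} = Tr_{n+2/n+1}`, `localTraceOfEmb_succ_eq_sum_pow_smul`), use (TR), then group `j' = j'' + pⁿ i`
(`g^{pⁿ i} d_n = d_n`, `pow_mul_smul_of_mem_localLayerPointsOfEmb`). This is the `P_{n,·}`-side twin of `eval₂_mazurTateElement_add_two_eq`
(Kobayashi's proof of Thm. 6.3: `π P_{n+1}^± = …`, trace relations of §8.4). [cite: Kobayashi2003, Def. 1.1, Thm. 6.3 (proof, p. 25)]
[cite: Sprung2012, Thm. 2.2 (p. 1487), Def. 3.1 (p. 1489)] -/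
theorem sum_evalOn_pow_smul_add_two_eq {R : Type*} [CommRing R] (φ : ℤ_[p] →+* R) {g : Field.absoluteGaloisGroup E}
    (hg : κ.IsTopGenerator (resGalOfEmb ι g)) {d : ℕ → localPoints W E}
    (hL : ∀ m, d m ∈ localLayerPointsOfEmb κ ι W m) (n : ℕ)
    (hTR : localTraceOfEmb κ ι W (n + 1) (n + 2) (d (n + 2)) = -d n)
    (z : localTowerPointsOfEmb κ ι W →+ ℤ_[p]) {ζ : R} (hζ : ζ ^ p ^ (n + 1) = 1) :
    ∑ j ∈ Finset.range (p ^ (n + 2)), φ (evalOn W (localTowerPointsOfEmb κ ι W) z (g ^ j • d (n + 2))) * ζ ^ j =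
      -((∑ i ∈ Finset.range p, ζ ^ (p ^ n * i)) *
        ∑ j ∈ Finset.range (p ^ n), φ (evalOn W (localTowerPointsOfEmb κ ι W) z (g ^ j • d n)) * ζ ^ j) := by
  have memA : ∀ (m j : ℕ), g ^ j • d m ∈ localTowerPointsOfEmb κ ι W := fun m j ↦
    localLayerPointsOfEmb_le_localTowerPointsOfEmb κ ι W m (smul_mem_localLayerPointsOfEmb κ ι W m (g ^ j) (hL m))
  have hζpow : ∀ a b : ℕ, ζ ^ (a + p ^ (n + 1) * b) = ζ ^ a := fun a b ↦ by
    rw [pow_add, pow_mul, hζ, one_pow, mul_one]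
  -- Step 1: group `j = i + p^{n+1} k` and use the trace relation
  have h1 : ∑ j ∈ Finset.range (p ^ (n + 2)), φ (evalOn W (localTowerPointsOfEmb κ ι W) z (g ^ j • d (n + 2))) * ζ ^ j =
      -∑ i ∈ Finset.range (p ^ (n + 1)), φ (evalOn W (localTowerPointsOfEmb κ ι W) z (g ^ i • d n)) * ζ ^ i := by
    rw [pow_succ, sum_range_mul_eq_sum_sum, Finset.sum_comm, ← Finset.sum_neg_distrib]
    refine Finset.sum_congr rfl fun i _ ↦ ?_
    have hsplit : ∀ k : ℕ, g ^ (i + p ^ (n + 1) * k) • d (n + 2) = g ^ i • (g ^ (p ^ (n + 1) * k) • d (n + 2)) := fun k ↦ by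
      rw [pow_add, mul_smul]
    simp_rw [hζpow, hsplit]
    rw [← Finset.sum_mul, ← neg_mul]
    congr 1
    have hmem : ∀ k ∈ Finset.range p, g ^ i • (g ^ (p ^ (n + 1) * k) • d (n + 2)) ∈ localTowerPointsOfEmb κ ι W := fun k _ ↦ by
      rw [← mul_smul, ← pow_add]; exact memA _ _
    rw [← evalOn_sum_of_mem W (localTowerPointsOfEmb κ ι W) z φ _ _ hmem, ← Finset.smul_sum,
      ← localTraceOfEmb_succ_eq_sum_pow_smul κ ι W hg (n + 1) (hL (n + 2)), hTR, smul_neg,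
      evalOn_neg_of_mem W (localTowerPointsOfEmb κ ι W) z φ (memA n i)]
  -- Step 2: group `i = j + pⁿ k` and use `g^{pⁿ k} d_n = d_n`
  have h2 : ∑ i ∈ Finset.range (p ^ (n + 1)), φ (evalOn W (localTowerPointsOfEmb κ ι W) z (g ^ i • d n)) * ζ ^ i =
      (∑ k ∈ Finset.range p, ζ ^ (p ^ n * k)) * ∑ j ∈ Finset.range (p ^ n), φ (evalOn W (localTowerPointsOfEmb κ ι W) z (g ^ j • d n)) * ζ ^ j := by
    rw [pow_succ, sum_range_mul_eq_sum_sum, Finset.sum_mul]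
    refine Finset.sum_congr rfl fun k _ ↦ ?_
    rw [Finset.mul_sum]
    refine Finset.sum_congr rfl fun j _ ↦ ?_
    rw [pow_add, mul_smul, pow_mul_smul_of_mem_localLayerPointsOfEmb κ ι W hg (hL n) k, pow_add]
    ring
  rw [h1, h2]

end Orbit

/-! ## §3 (appended) The P-side relation for a functional on ANY subgroup containing the two orbits (layer functionals) -/

section OrbitGeneral

universe u

variable {K : Type u} [Field K] {p : ℕ} [hp : Fact p.Prime] (κ : ZpExtension K p)
  {E : Type u} [Field E] [Algebra K E] (ι : AlgebraicClosure K →ₐ[K] AlgebraicClosure E)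
  (W : WeierstrassCurve K)

/-- **The P-side distribution relation at `a_p = 0` for a functional on ANY additive subgroup `A`** containing the `g`-orbits of `d_{n+2}` and `d_n`
(e.g. `A = E(K_{n+2}·E)` and `z = ` THE layer pairing functional `pair (n+2) (proj (n+2) s)`, the col₀-free currency of CORE_pair): same statement and
proof as `sum_evalOn_pow_smul_add_two_eq` (which is the case `A = E(K_∞·E)`):
`∑_{j<p^{n+2}} φ(z(gʲ d_{n+2})) ζʲ = −(∑_{i<p} ζ^{pⁿ i}) · ∑_{j<pⁿ} φ(z(gʲ d_n)) ζʲ` for `ζ^{p^{n+1}} = 1`.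
[cite: Kobayashi2003, Def. 1.1, Thm. 6.3 (proof, p. 25)] [cite: Sprung2012, Thm. 2.2 (p. 1487), Def. 3.1 (p. 1489)] -/
theorem sum_evalOn_pow_smul_add_two_eq_of_mem {R : Type*} [CommRing R] (φ : ℤ_[p] →+* R) {g : Field.absoluteGaloisGroup E}
    (hg : κ.IsTopGenerator (resGalOfEmb ι g)) {d : ℕ → localPoints W E}
    (hL : ∀ m, d m ∈ localLayerPointsOfEmb κ ι W m) (n : ℕ)
    (hTR : localTraceOfEmb κ ι W (n + 1) (n + 2) (d (n + 2)) = -d n)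
    (A : AddSubgroup (localPoints W E)) (hA2 : ∀ j : ℕ, g ^ j • d (n + 2) ∈ A) (hA0 : ∀ j : ℕ, g ^ j • d n ∈ A)
    (z : A →+ ℤ_[p]) {ζ : R} (hζ : ζ ^ p ^ (n + 1) = 1) :
    ∑ j ∈ Finset.range (p ^ (n + 2)), φ (evalOn W A z (g ^ j • d (n + 2))) * ζ ^ j =
      -((∑ i ∈ Finset.range p, ζ ^ (p ^ n * i)) *
        ∑ j ∈ Finset.range (p ^ n), φ (evalOn W A z (g ^ j • d n)) * ζ ^ j) := by
  have hζpow : ∀ a b : ℕ, ζ ^ (a + p ^ (n + 1) * b) = ζ ^ a := fun a b ↦ by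
    rw [pow_add, pow_mul, hζ, one_pow, mul_one]
  -- Step 1: group `j = i + p^{n+1} k` and use the trace relation
  have h1 : ∑ j ∈ Finset.range (p ^ (n + 2)), φ (evalOn W A z (g ^ j • d (n + 2))) * ζ ^ j =
      -∑ i ∈ Finset.range (p ^ (n + 1)), φ (evalOn W A z (g ^ i • d n)) * ζ ^ i := by
    rw [pow_succ, sum_range_mul_eq_sum_sum, Finset.sum_comm, ← Finset.sum_neg_distrib]
    refine Finset.sum_congr rfl fun i _ ↦ ?_
    have hsplit : ∀ k : ℕ, g ^ (i + p ^ (n + 1) * k) • d (n + 2) = g ^ i • (g ^ (p ^ (n + 1) * k) • d (n + 2)) := fun k ↦ by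
      rw [pow_add, mul_smul]
    simp_rw [hζpow, hsplit]
    rw [← Finset.sum_mul, ← neg_mul]
    congr 1
    have hmem : ∀ k ∈ Finset.range p, g ^ i • (g ^ (p ^ (n + 1) * k) • d (n + 2)) ∈ A := fun k _ ↦ by
      rw [← mul_smul, ← pow_add]; exact hA2 _
    rw [← evalOn_sum_of_mem W A z φ _ _ hmem, ← Finset.smul_sum,
      ← localTraceOfEmb_succ_eq_sum_pow_smul κ ι W hg (n + 1) (hL (n + 2)), hTR, smul_neg,
      evalOn_neg_of_mem W A z φ (hA0 i)]
  -- Step 2: group `i = j + pⁿ k` and use `g^{pⁿ k} d_n = d_n`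
  have h2 : ∑ i ∈ Finset.range (p ^ (n + 1)), φ (evalOn W A z (g ^ i • d n)) * ζ ^ i =
      (∑ k ∈ Finset.range p, ζ ^ (p ^ n * k)) * ∑ j ∈ Finset.range (p ^ n), φ (evalOn W A z (g ^ j • d n)) * ζ ^ j := by
    rw [pow_succ, sum_range_mul_eq_sum_sum, Finset.sum_mul]
    refine Finset.sum_congr rfl fun k _ ↦ ?_
    rw [Finset.mul_sum]
    refine Finset.sum_congr rfl fun j _ ↦ ?_
    rw [pow_add, mul_smul, pow_mul_smul_of_mem_localLayerPointsOfEmb κ ι W hg (hL n) k, pow_add]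
    ring
  rw [h1, h2]

end OrbitGeneral

end Summit.BirchSwinnertonDyer.BirchSwinnertonDyer.Theorems.SignedKatoOffTwo.CoreChi

end
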